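import Summits.QuantumFields.GaugeBoot.BootstrapWordTruncation
import HarnessLib

/-!
# Word spaces: polynomial observables of bounded word length supported on a set of links (gauge-boot, L1 supplement)

HONEST FRAMING (cell `pub-gaugeboot`, page 1 of every file): the venture produces certified bounds
on lattice expectations at stated coupling, gauge group, dimension and torus size; NOT a mass gap,
NOT a continuum limit, NOT a string tension; NOT Yang–Mills-summit-bearing (barriers
`FixedCouplingUltralocality`, `PerturbativeInvisibility`). Bookkeeping only; it certifies no number.

## Content

The graded, localised pieces of the polynomial observables (`PolynomialObservables.polyAlgebra`)
used by the strong-coupling-order analysis of the truncated bootstrap: `entryGensOn r S` (generators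
`Re/Im ρ(U_e)_{ab}`, `e ∈ S`), `wordsOn r S n` (products of `≤ n` of them), `wordSpace r S n` (their
`ℝ`-span; at `S = univ` the tree's `wordTruncation r n`, `coe_wordSpace_univ`), `wordFunctions r S n`
(as plain functions); `mul_mem_wordSpace` (degrees add); ★ `finiteDimensional_wordSpace` (finite `S`:
finitely many words over a finite alphabet); ★ `apply_eq_of_mem_wordSpace` (locality: dependence on
`U_e`, `e ∈ S`, only); matrix bookkeeping `EntriesIn` and `const_sub_reTrace_word₄_mem_wordFunctions`
(a plaquette term `C - Re tr ρ(U_a U_b U_c⁻¹ U_d⁻¹)` has degree `4` on `{a, b, c, d}`).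

References: V. Kazakov, Z. Zheng, arXiv:2203.11360 §2; P. Anderson, M. Kruczenski (2017). Folklore.
-/

noncomputable section

open scoped Matrix
open Literature.MathematicalPhysics.QuantumFieldTheory (LatticeRep)

namespace Summit.QuantumFields.GaugeBoot

variable {ι : Type*} {G : Type*} [Group G] [TopologicalSpace G] (r : LatticeRep G)

/-! ## Generators at a set of links -/

/-- **Generators at the links of `S`**: `Re ρ(U_e)_{ab}` and `Im ρ(U_e)_{ab}` for `e ∈ S`. [folklore] -/
def entryGensOn (S : Set ι) : Set C(ι → G, ℝ) :=
  (fun p : ι × Fin r.N × Fin r.N => reEntry r p.1 p.2.1 p.2.2) '' (S ×ˢ Set.univ) ∪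
    (fun p : ι × Fin r.N × Fin r.N => imEntry r p.1 p.2.1 p.2.2) '' (S ×ˢ Set.univ)

variable {r}

/-- Real parts of entries at links of `S` are generators at `S`. -/
theorem reEntry_mem_entryGensOn {S : Set ι} {e : ι} (he : e ∈ S) (a b : Fin r.N) :
    reEntry r e a b ∈ entryGensOn r S :=
  Or.inl ⟨(e, a, b), Set.mk_mem_prod he (Set.mem_univ _), rfl⟩

/-- Imaginary parts of entries at links of `S` are generators at `S`. -/
theorem imEntry_mem_entryGensOn {S : Set ι} {e : ι} (he : e ∈ S) (a b : Fin r.N) :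
    imEntry r e a b ∈ entryGensOn r S :=
  Or.inr ⟨(e, a, b), Set.mk_mem_prod he (Set.mem_univ _), rfl⟩

/-- A generator at `S` is `Re` or `Im` of an entry of some link of `S`. -/
theorem exists_of_mem_entryGensOn {S : Set ι} {x : C(ι → G, ℝ)} (hx : x ∈ entryGensOn r S) :
    ∃ e ∈ S, ∃ a b : Fin r.N, x = reEntry r e a b ∨ x = imEntry r e a b := by
  rcases hx with ⟨p, hp, rfl⟩ | ⟨p, hp, rfl⟩
  · exact ⟨p.1, (Set.mem_prod.1 hp).1, p.2.1, p.2.2, Or.inl rfl⟩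
  · exact ⟨p.1, (Set.mem_prod.1 hp).1, p.2.1, p.2.2, Or.inr rfl⟩

variable (r)

/-- More links, more generators. -/
theorem entryGensOn_mono {S T : Set ι} (h : S ⊆ T) : entryGensOn r S ⊆ entryGensOn r T := by
  rintro x (⟨p, hp, rfl⟩ | ⟨p, hp, rfl⟩)
  · exact Or.inl ⟨p, Set.mk_mem_prod (h (Set.mem_prod.1 hp).1) (Set.mem_univ _), rfl⟩
  · exact Or.inr ⟨p, Set.mk_mem_prod (h (Set.mem_prod.1 hp).1) (Set.mem_univ _), rfl⟩

/-- Generators at `S` are generators. -/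
theorem entryGensOn_subset_entryGens (S : Set ι) : entryGensOn r S ⊆ entryGens (ι := ι) r := by
  rintro x (⟨p, -, rfl⟩ | ⟨p, -, rfl⟩)
  · exact Or.inl ⟨p, rfl⟩
  · exact Or.inr ⟨p, rfl⟩

/-- At `S = univ` the generators at `S` are all generators. -/
theorem entryGensOn_univ : entryGensOn r (Set.univ : Set ι) = entryGens (ι := ι) r := by
  refine Set.Subset.antisymm (entryGensOn_subset_entryGens r _) ?_
  rintro x (⟨p, rfl⟩ | ⟨p, rfl⟩)
  · exact Or.inl ⟨p, Set.mk_mem_prod (Set.mem_univ _) (Set.mem_univ _), rfl⟩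
  · exact Or.inr ⟨p, Set.mk_mem_prod (Set.mem_univ _) (Set.mem_univ _), rfl⟩

/-- Finitely many links carry finitely many generators. -/
theorem entryGensOn_finite {S : Set ι} (hS : S.Finite) : (entryGensOn r S).Finite :=
  ((hS.prod Set.finite_univ).image _).union ((hS.prod Set.finite_univ).image _)

/-- A generator at `S` depends on the links of `S` only. -/
theorem apply_eq_of_mem_entryGensOn {S : Set ι} {x : C(ι → G, ℝ)} (hx : x ∈ entryGensOn r S)
    {U V : ι → G} (hUV : ∀ i ∈ S, U i = V i) : x U = x V := by
  obtain ⟨e, he, a, b, rfl | rfl⟩ := exists_of_mem_entryGensOn hx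
  · rw [reEntry_apply, reEntry_apply, hUV e he]
  · rw [imEntry_apply, imEntry_apply, hUV e he]

/-! ## Words of bounded length at a set of links -/
/-- **Words of length `≤ n` at the links of `S`**: products of at most `n` generators at `S`
(Wilson lines / open strings of length `≤ n` inside `S`, entry by entry). [folklore] -/
def wordsOn (S : Set ι) (n : ℕ) : Set C(ι → G, ℝ) :=
  {m | ∃ l : List C(ι → G, ℝ), (∀ x ∈ l, x ∈ entryGensOn r S) ∧ l.length ≤ n ∧ l.prod = m}

/-- Monotone in the link set and the length. -/
theorem wordsOn_mono {S T : Set ι} (hST : S ⊆ T) {m n : ℕ} (hmn : m ≤ n) :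
    wordsOn r S m ⊆ wordsOn r T n := by
  rintro w ⟨l, hl, hlen, rfl⟩
  exact ⟨l, fun x hx => entryGensOn_mono r hST (hl x hx), hlen.trans hmn, rfl⟩

/-- The empty word. -/
theorem one_mem_wordsOn (S : Set ι) (n : ℕ) : (1 : C(ι → G, ℝ)) ∈ wordsOn r S n :=
  ⟨[], fun _ h => by simp at h, by simp, rfl⟩

/-- Generators are words of length `1`. -/
theorem mem_wordsOn_of_mem_entryGensOn {S : Set ι} {x : C(ι → G, ℝ)} (hx : x ∈ entryGensOn r S)
    {n : ℕ} (hn : 1 ≤ n) : x ∈ wordsOn r S n :=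
  ⟨[x], fun y hy => by rw [List.mem_singleton.1 hy]; exact hx, by simpa using hn, by simp⟩

/-- Words multiply, lengths add. -/
theorem mul_mem_wordsOn {S : Set ι} {m n : ℕ} {v w : C(ι → G, ℝ)} (hv : v ∈ wordsOn r S m)
    (hw : w ∈ wordsOn r S n) : v * w ∈ wordsOn r S (m + n) := by
  obtain ⟨lv, hlv, hlvn, rfl⟩ := hv
  obtain ⟨lw, hlw, hlwn, rfl⟩ := hw
  refine ⟨lv ++ lw, fun x hx => ?_, ?_, List.prod_append⟩
  · rcases List.mem_append.1 hx with hx | hx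
    · exact hlv x hx
    · exact hlw x hx
  · rw [List.length_append]
    exact add_le_add hlvn hlwn

/-- At `S = univ` these are the tree's words of bounded length. -/
theorem wordsOn_univ (n : ℕ) : wordsOn r (Set.univ : Set ι) n = wordsUpTo (ι := ι) r n := by
  ext w
  simp only [wordsOn, wordsUpTo, entryGensOn_univ, Set.mem_setOf_eq]

/-- Words at `S` are words. -/
theorem wordsOn_subset_wordsUpTo (S : Set ι) (n : ℕ) : wordsOn r S n ⊆ wordsUpTo (ι := ι) r n := by
  rw [← wordsOn_univ]
  exact wordsOn_mono r (Set.subset_univ S) le_rfl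

/-- Words are monomials in the generators. -/
theorem wordsOn_subset_closure (S : Set ι) (n : ℕ) :
    wordsOn r S n ⊆ Submonoid.closure (entryGens (ι := ι) r) :=
  (wordsOn_subset_wordsUpTo r S n).trans (wordsUpTo_subset_closure r n)

/-- ★ **Finitely many links, bounded length: finitely many words.** [folklore] -/
theorem wordsOn_finite {S : Set ι} (hS : S.Finite) (n : ℕ) : (wordsOn r S n).Finite := by
  haveI : Finite (entryGensOn r S) := (entryGensOn_finite r hS).to_subtype
  refine ((List.finite_length_le (entryGensOn r S) n).image
    fun l => (l.map Subtype.val).prod).subset ?_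
  rintro w ⟨l, hl, hlen, rfl⟩
  refine ⟨l.pmap Subtype.mk hl, ?_, ?_⟩
  · simpa using hlen
  · simp only [List.map_pmap, List.pmap_eq_map, List.map_id']

/-- Every word of bounded length lives on finitely many links. -/
theorem exists_finite_mem_wordsOn_of_mem_wordsUpTo {n : ℕ} {w : C(ι → G, ℝ)}
    (hw : w ∈ wordsUpTo (ι := ι) r n) : ∃ S : Set ι, S.Finite ∧ w ∈ wordsOn r S n := by
  classical
  obtain ⟨l, hl, hlen, rfl⟩ := hw
  rw [← entryGensOn_univ] at hl
  choose e he using fun x (hx : x ∈ l) => exists_of_mem_entryGensOn (hl x hx)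
  refine ⟨{i | i ∈ l.attach.map fun x => e x.1 x.2}, List.finite_toSet _, l, fun x hx => ?_, hlen, rfl⟩
  have hi : e x hx ∈ ({i | i ∈ l.attach.map fun x => e x.1 x.2} : Set ι) :=
    List.mem_map.2 ⟨⟨x, hx⟩, List.mem_attach _ _, rfl⟩
  obtain ⟨-, a, b, h | h⟩ := he x hx
  · rw [h]; exact reEntry_mem_entryGensOn hi a b
  · rw [h]; exact imEntry_mem_entryGensOn hi a b

/-- A word at `S` depends on the links of `S` only. -/
theorem apply_eq_of_mem_wordsOn {S : Set ι} {n : ℕ} {w : C(ι → G, ℝ)} (hw : w ∈ wordsOn r S n)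
    {U V : ι → G} (hUV : ∀ i ∈ S, U i = V i) : w U = w V := by
  obtain ⟨l, hl, -, rfl⟩ := hw
  induction l with
  | nil => simp
  | cons x l ih =>
    rw [List.prod_cons, ContinuousMap.mul_apply, ContinuousMap.mul_apply,
      apply_eq_of_mem_entryGensOn r (hl x List.mem_cons_self) hUV,
      ih fun y hy => hl y (List.mem_cons_of_mem x hy)]

/-! ## Word spaces -/
/-- **The word space of degree `n` at `S`**: the `ℝ`-span of the words of length `≤ n` at the links
of `S` — the level-`n` test functions of the word-length truncation localised to `S`. [folklore] -/
def wordSpace (S : Set ι) (n : ℕ) : Submodule ℝ C(ι → G, ℝ) := Submodule.span ℝ (wordsOn r S n)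

/-- **The same as plain functions** (image under the coercion `C(ι → G, ℝ) → ((ι → G) → ℝ)`). -/
def wordFunctions (S : Set ι) (n : ℕ) : Submodule ℝ ((ι → G) → ℝ) :=
  (wordSpace r S n).map (ContinuousMap.coeFnAlgHom ℝ : C(ι → G, ℝ) →ₐ[ℝ] (ι → G) → ℝ).toLinearMap

/-- Words span the word space. -/
theorem subset_wordSpace (S : Set ι) (n : ℕ) : wordsOn r S n ⊆ wordSpace r S n :=
  Submodule.subset_span

/-- Monotone in the link set and the degree. -/
theorem wordSpace_mono {S T : Set ι} (hST : S ⊆ T) {m n : ℕ} (hmn : m ≤ n) :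
    wordSpace r S m ≤ wordSpace r T n :=
  Submodule.span_mono (wordsOn_mono r hST hmn)

/-- `1` is in every word space. -/
theorem one_mem_wordSpace (S : Set ι) (n : ℕ) : (1 : C(ι → G, ℝ)) ∈ wordSpace r S n :=
  subset_wordSpace r S n (one_mem_wordsOn r S n)

/-- Constants are in every word space. -/
theorem algebraMap_mem_wordSpace (S : Set ι) (n : ℕ) (c : ℝ) :
    algebraMap ℝ C(ι → G, ℝ) c ∈ wordSpace r S n := by
  rw [Algebra.algebraMap_eq_smul_one]
  exact Submodule.smul_mem _ c (one_mem_wordSpace r S n)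

/-- Generators at `S` are in the word spaces of positive degree. -/
theorem mem_wordSpace_of_mem_entryGensOn {S : Set ι} {x : C(ι → G, ℝ)} (hx : x ∈ entryGensOn r S)
    {n : ℕ} (hn : 1 ≤ n) : x ∈ wordSpace r S n :=
  subset_wordSpace r S n (mem_wordsOn_of_mem_entryGensOn r hx hn)

/-- ★ **Word spaces multiply, degrees add.** [folklore] -/
theorem mul_mem_wordSpace {S : Set ι} {m n : ℕ} {f g : C(ι → G, ℝ)} (hf : f ∈ wordSpace r S m)
    (hg : g ∈ wordSpace r S n) : f * g ∈ wordSpace r S (m + n) := by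
  have h := Submodule.mul_mem_mul hf hg
  rw [wordSpace, wordSpace, Submodule.span_mul_span] at h
  refine Submodule.span_mono ?_ h
  rintro _ ⟨v, hv, w, hw, rfl⟩
  exact mul_mem_wordsOn r hv hw

/-- Word spaces consist of polynomial observables. -/
theorem wordSpace_le_polyAlgebra (S : Set ι) (n : ℕ) :
    wordSpace r S n ≤ Subalgebra.toSubmodule (polyAlgebra (ι := ι) r) :=
  Submodule.span_le.2 fun _ hw => mem_polyAlgebra_of_mem_closure r (wordsOn_subset_closure r S n hw)

/-- Elements of word spaces are polynomial observables. -/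
theorem mem_polyAlgebra_of_mem_wordSpace {S : Set ι} {n : ℕ} {f : C(ι → G, ℝ)}
    (hf : f ∈ wordSpace r S n) : f ∈ polyAlgebra (ι := ι) r :=
  wordSpace_le_polyAlgebra r S n hf

/-- ★ **At `S = univ` the word space is the tree's word-length truncation.** -/
theorem coe_wordSpace_univ (n : ℕ) :
    (wordSpace r (Set.univ : Set ι) n : Set C(ι → G, ℝ)) = wordTruncation (ι := ι) r n := by
  rw [wordSpace, wordsOn_univ]
  rfl

/-- Elements of word spaces are level-`n` test functions of the word-length truncation. -/
theorem mem_wordTruncation_of_mem_wordSpace {S : Set ι} {n : ℕ} {f : C(ι → G, ℝ)}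
    (hf : f ∈ wordSpace r S n) : f ∈ wordTruncation (ι := ι) r n := by
  rw [← coe_wordSpace_univ]
  exact wordSpace_mono r (Set.subset_univ S) le_rfl hf

/-- Level-`n` test functions are in the word space at `univ`. -/
theorem mem_wordSpace_univ_of_mem_wordTruncation {n : ℕ} {f : C(ι → G, ℝ)}
    (hf : f ∈ wordTruncation (ι := ι) r n) : f ∈ wordSpace r (Set.univ : Set ι) n := by
  rw [← SetLike.mem_coe, coe_wordSpace_univ]
  exact hf

/-- ★ **Every level-`n` test function lives on finitely many links.** [folklore] -/
theorem exists_finite_mem_wordSpace_of_mem_wordTruncation {n : ℕ} {f : C(ι → G, ℝ)}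
    (hf : f ∈ wordTruncation (ι := ι) r n) : ∃ S : Set ι, S.Finite ∧ f ∈ wordSpace r S n := by
  classical
  obtain ⟨k, c, g, hsum⟩ := Submodule.mem_span_set'.1 (show f ∈ Submodule.span ℝ (wordsUpTo r n) from hf)
  choose S hS hgS using fun j => exists_finite_mem_wordsOn_of_mem_wordsUpTo r (g j).2
  refine ⟨⋃ j, S j, Set.finite_iUnion hS, ?_⟩
  rw [← hsum]
  exact Submodule.sum_mem _ fun j _ => Submodule.smul_mem _ _
    (subset_wordSpace r _ n (wordsOn_mono r (Set.subset_iUnion S j) le_rfl (hgS j)))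

/-- ★ **Finitely many links: the word spaces are finite-dimensional.** [folklore] -/
theorem finiteDimensional_wordSpace {S : Set ι} (hS : S.Finite) (n : ℕ) :
    FiniteDimensional ℝ (wordSpace r S n) :=
  FiniteDimensional.span_of_finite ℝ (wordsOn_finite r hS n)

/-- ★ **Locality: an element of the word space at `S` depends on the link variables at `S` only.**
[folklore] -/
theorem apply_eq_of_mem_wordSpace {S : Set ι} {n : ℕ} {f : C(ι → G, ℝ)} (hf : f ∈ wordSpace r S n)
    {U V : ι → G} (hUV : ∀ i ∈ S, U i = V i) : f U = f V := by
  induction hf using Submodule.span_induction with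
  | mem w hw => exact apply_eq_of_mem_wordsOn r hw hUV
  | zero => rfl
  | add f g _ _ hf hg => rw [ContinuousMap.add_apply, ContinuousMap.add_apply, hf, hg]
  | smul c f _ hf => rw [ContinuousMap.smul_apply, ContinuousMap.smul_apply, hf]

/-- Membership of plain functions. -/
theorem mem_wordFunctions_iff {S : Set ι} {n : ℕ} {f : (ι → G) → ℝ} :
    f ∈ wordFunctions r S n ↔ ∃ g ∈ wordSpace r S n, ⇑g = f :=
  Submodule.mem_map

/-- A continuous map is a word function iff it is in the word space. -/
theorem coe_mem_wordFunctions_iff {S : Set ι} {n : ℕ} {g : C(ι → G, ℝ)} :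
    ⇑g ∈ wordFunctions r S n ↔ g ∈ wordSpace r S n := by
  rw [mem_wordFunctions_iff]
  constructor
  · rintro ⟨g', hg', h⟩
    rwa [← ContinuousMap.coe_injective h]
  · exact fun h => ⟨g, h, rfl⟩

/-- Word functions are monotone in the link set and the degree. -/
theorem wordFunctions_mono {S T : Set ι} (hST : S ⊆ T) {m n : ℕ} (hmn : m ≤ n) :
    wordFunctions r S m ≤ wordFunctions r T n :=
  Submodule.map_mono (wordSpace_mono r hST hmn)

/-- Word functions multiply, degrees add. -/
theorem mul_mem_wordFunctions {S : Set ι} {m n : ℕ} {f g : (ι → G) → ℝ} (hf : f ∈ wordFunctions r S m)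
    (hg : g ∈ wordFunctions r S n) : f * g ∈ wordFunctions r S (m + n) := by
  obtain ⟨f', hf', rfl⟩ := (mem_wordFunctions_iff r).1 hf
  obtain ⟨g', hg', rfl⟩ := (mem_wordFunctions_iff r).1 hg
  exact (mem_wordFunctions_iff r).2 ⟨f' * g', mul_mem_wordSpace r hf' hg', rfl⟩

/-- Constants are word functions. -/
theorem const_mem_wordFunctions (S : Set ι) (n : ℕ) (c : ℝ) :
    (fun _ : ι → G => c) ∈ wordFunctions r S n :=
  (mem_wordFunctions_iff r).2 ⟨algebraMap ℝ C(ι → G, ℝ) c, algebraMap_mem_wordSpace r S n c,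
    funext fun U => by simp [Algebra.algebraMap_eq_smul_one]⟩

/-! ## Matrix-valued observables with entries in a word space -/

/-- A matrix-valued function of the configuration whose entries (real and imaginary parts) are
word functions of degree `n` at `S`. [shape] A parametric definition of a proposition — NOT a fact.
[folklore] -/
def EntriesIn (S : Set ι) (n : ℕ) (M : (ι → G) → Matrix (Fin r.N) (Fin r.N) ℂ) : Prop :=
  ∀ a b, (fun U => (M U a b).re) ∈ wordFunctions r S n ∧ (fun U => (M U a b).im) ∈ wordFunctions r S n

/-- The link variable at `e ∈ S` has entries in degree `1`. -/
theorem entriesIn_rho {S : Set ι} {e : ι} (he : e ∈ S) {n : ℕ} (hn : 1 ≤ n) :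
    EntriesIn r S n (fun U : ι → G => r.ρ (U e)) := fun a b =>
  ⟨(coe_mem_wordFunctions_iff r (g := reEntry r e a b)).2
      (mem_wordSpace_of_mem_entryGensOn r (reEntry_mem_entryGensOn he a b) hn),
    (coe_mem_wordFunctions_iff r (g := imEntry r e a b)).2
      (mem_wordSpace_of_mem_entryGensOn r (imEntry_mem_entryGensOn he a b) hn)⟩

/-- Products: degrees add. -/
theorem EntriesIn.mul {S : Set ι} {m n : ℕ} {M P : (ι → G) → Matrix (Fin r.N) (Fin r.N) ℂ}
    (hM : EntriesIn r S m M) (hP : EntriesIn r S n P) :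
    EntriesIn r S (m + n) (fun U => M U * P U) := by
  intro a b
  have hre : (fun U => ((M U * P U) a b).re) =
      ∑ c, ((fun U => (M U a c).re) * (fun U => (P U c b).re) -
        (fun U => (M U a c).im) * (fun U => (P U c b).im)) := by
    funext U
    simp [Matrix.mul_apply, Complex.re_sum, Complex.mul_re, Finset.sum_apply]
  have him : (fun U => ((M U * P U) a b).im) =
      ∑ c, ((fun U => (M U a c).re) * (fun U => (P U c b).im) +
        (fun U => (M U a c).im) * (fun U => (P U c b).re)) := by
    funext U
    simp [Matrix.mul_apply, Complex.im_sum, Complex.mul_im, Finset.sum_apply]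
  refine ⟨?_, ?_⟩
  · rw [hre]
    exact Submodule.sum_mem _ fun c _ => Submodule.sub_mem _
      (mul_mem_wordFunctions r (hM a c).1 (hP c b).1) (mul_mem_wordFunctions r (hM a c).2 (hP c b).2)
  · rw [him]
    exact Submodule.sum_mem _ fun c _ => Submodule.add_mem _
      (mul_mem_wordFunctions r (hM a c).1 (hP c b).2) (mul_mem_wordFunctions r (hM a c).2 (hP c b).1)

/-- The inverse link variable at `e ∈ S` has entries in degree `1` (`ρ(g⁻¹) = ρ(g)ᴴ`, as in the
tree's `onelink_rho_inv` / `entriesPoly_rho_inv`). -/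
theorem entriesIn_rho_inv {S : Set ι} {e : ι} (he : e ∈ S) {n : ℕ} (hn : 1 ≤ n) :
    EntriesIn r S n (fun U : ι → G => r.ρ ((U e)⁻¹)) := by
  intro a b
  have rho_inv_eq_conjTranspose : ∀ g : G, r.ρ g⁻¹ = (r.ρ g)ᴴ := fun g => by
    have h1 : r.ρ g⁻¹ * r.ρ g = 1 := by rw [← map_mul, inv_mul_cancel, map_one]
    have h2 : (r.ρ g)ᴴ * r.ρ g = 1 := by
      have := Matrix.mem_unitaryGroup_iff'.1 (r.mem_unitary g)
      rwa [Matrix.star_eq_conjTranspose] at this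
    rw [← Matrix.inv_eq_left_inv h1, Matrix.inv_eq_left_inv h2]
  have h1 : (fun U : ι → G => (r.ρ ((U e)⁻¹) a b).re) = fun U => (r.ρ (U e) b a).re := by
    funext U
    rw [rho_inv_eq_conjTranspose, Matrix.conjTranspose_apply, Complex.star_def, Complex.conj_re]
  have h2 : (fun U : ι → G => (r.ρ ((U e)⁻¹) a b).im) = -fun U => (r.ρ (U e) b a).im := by
    funext U
    rw [Pi.neg_apply, rho_inv_eq_conjTranspose, Matrix.conjTranspose_apply, Complex.star_def,
      Complex.conj_im]
  change (fun U : ι → G => (r.ρ ((U e)⁻¹) a b).re) ∈ wordFunctions r S n ∧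
    (fun U : ι → G => (r.ρ ((U e)⁻¹) a b).im) ∈ wordFunctions r S n
  rw [h1, h2]
  exact ⟨(entriesIn_rho r he hn b a).1, Submodule.neg_mem _ (entriesIn_rho r he hn b a).2⟩

/-- `Re tr` of a matrix observable with entries in a word space is in the word space. -/
theorem EntriesIn.trace_re {S : Set ι} {n : ℕ} {M : (ι → G) → Matrix (Fin r.N) (Fin r.N) ℂ}
    (hM : EntriesIn r S n M) : (fun U => (M U).trace.re) ∈ wordFunctions r S n := by
  have h : (fun U => (M U).trace.re) = ∑ a, fun U => (M U a a).re := by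
    funext U
    simp [Matrix.trace, Complex.re_sum, Finset.sum_apply]
  rw [h]
  exact Submodule.sum_mem _ fun a _ => (hM a a).1

/-- `C - Re tr` of a matrix observable with entries in a word space is in the word space. -/
theorem EntriesIn.const_sub_trace_re {S : Set ι} {n : ℕ} {M : (ι → G) → Matrix (Fin r.N) (Fin r.N) ℂ}
    (hM : EntriesIn r S n M) (C : ℝ) : (fun U => C - (M U).trace.re) ∈ wordFunctions r S n := by
  have h : (fun U => C - (M U).trace.re) = (fun _ => C) - fun U => (M U).trace.re := by
    funext U
    simp
  rw [h]
  exact Submodule.sub_mem _ (const_mem_wordFunctions r S n C) hM.trace_re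

/-- ★ **A plaquette term `C - Re tr ρ(U_a U_b U_c⁻¹ U_d⁻¹)` with `a, b, c, d ∈ S` is a word function
of degree `4` at `S`.** [folklore] -/
theorem const_sub_reTrace_word₄_mem_wordFunctions {S : Set ι} {a b c d : ι} (ha : a ∈ S)
    (hb : b ∈ S) (hc : c ∈ S) (hd : d ∈ S) (C : ℝ) :
    (fun U : ι → G => C - (r.ρ (U a * U b * (U c)⁻¹ * (U d)⁻¹)).trace.re) ∈ wordFunctions r S 4 := by
  have h : EntriesIn r S 4 (fun U : ι → G => r.ρ (U a * U b * (U c)⁻¹ * (U d)⁻¹)) := by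
    have := (((entriesIn_rho r ha le_rfl).mul r (entriesIn_rho r hb le_rfl)).mul r
      (entriesIn_rho_inv r hc le_rfl)).mul r (entriesIn_rho_inv r hd le_rfl)
    simpa only [map_mul] using this
  exact h.const_sub_trace_re r C

end Summit.QuantumFields.GaugeBoot

end
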